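import Summits.QuantumFields.YangMills.Theorems.BalabanUVNodesN11KernelRTSectionIntegrable
import Summits.QuantumFields.YangMills.Theorems.BalabanUVNodesN11TkBranchMassBound

/-!
# DAG node N11 — THE `hint` ROW OF THE BRANCH-SUM JUNCTION IS REDUNDANT UNDER POSITIVITY: graph-product integrability of the NEW inside integrands from the
# inner reading `hin`, the summed inner identification `hinnerSum` and nonnegativity; p619836's junction and identity of (O3′) `_of_nonneg` ∕ `_of_laws`

WHY.  p622291 (`…N11KernelRTSectionIntegrable`, this seat) replaced the row `hint` of dag-n11-d g15's branch-sum junction p619836 by joint measurability `hgm` and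
GRAPH-PRODUCT INTEGRABILITY `hI` of the explicit inside integrands `G_i(q, y) = ζ_i(ω_{y,q})·(aOp k sA_i w_i Φ_i)(ω_{y,q})` against `Π_{sV_k} Haar ⊗ Π_{sV'ᶜ} Haar`.  This
sequel DISCHARGES `hI` from rows the junction ALREADY displays: the inner reading `Fᵢ` is a kernel transport of def-T's integrable graph integrand (`hin`), hence
integrable on `Π_{sV_k} Haar ⊗ Π_{sV'ᶜ} Haar`; `hinnerSum` identifies `Fᵢ` on every averaging fibre with `Σ_i G_i`; so when the `G_i` are NONNEGATIVE (11a's weight laws: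
`ζ ≥ 0`, `w ≥ 0`, nonnegative operands — 𝐓_k(s′,S) preserves positivity) each `G_i` along the graph is dominated by the integrable `Fᵢ` (`Integrable.mono'`).  Net effect on
the (O3′) producer: `hint` is GONE — the identity `slotsTOfRecord … (k+1) s′ =ᵐ[dV′] 𝐓_{k+1}(s′)Φ` holds modulo `hG` ∕ `hin` ∕ `hinnerSum`, the weight LAWS, a nonnegative operand
and joint measurability of the explicit integrands (dag-n11-d g10's `…TkOpMeasurable` rows).

WHAT THIS FILE PROVES (0 `sorry`, 0 `def`).  §1 (abstract integrable density `ρ` on `dU`, saturated region `Y`, bond sets `bondsIn k Y` ∕ `bondsIn (k+1) Y`):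
★ `integrable_innerReading` (the inner reading `Fᵢ` of `hin` is integrable on `Π_{sV_k} Haar ⊗ Π_{sV'ᶜ} Haar` — `integrable_kernelTransport` along the skew presentation, dag-n11-e's
`hac_in` and glue BY NAME), ★★ `integrable_graph_of_fibre_sum_of_nonneg` (a finite NONNEGATIVE jointly measurable family summing to `Fᵢ` on the averaging fibres, a.e., is
graph-product integrable member by member).  §2 ★★★ `tstepOfRecord_comp_glue_ae_eq_sum_genOp_of_nonneg` — p619836 §2 with `hint` REPLACED by `hgm` + pointwise
nonnegativity `hG0` of the explicit integrands (p622291 §3 fed by §1).  §3 ★★★ `slotsTOfRecord_succ_ae_eq_TkOfRecord_succ_of_innerSum_of_laws` — p619836 §3's identity of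
(O3′) on the nose with `hint` REPLACED by `hgm` + the weight laws `W.Laws` + a nonnegative operand `hΦ0` (nonnegativity of `ζ·aOp(…)(𝐓_k(s′,S)Φ_S)` by 11a's `aOp_nonneg`,
`genDataOfRecord_laws` and this lineage's `tkBranchOfRecord_nonneg'`).

HONEST SCOPE.  Width seat dag-n11-w2 (g3), sequel to hand-out X-w2a; helper lane of K1⁸ `stmt-QuantumFields-26907`, count-neutral.  [folklore] measure theory (domination,
quasi-measure-preserving pull-back of a.e. statements) over def-T's ∕ 11a's OWN kernels and dag-n11-e's presentation lemmas, all BY NAME; nothing of p619836 ∕ p622291 re-typed.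
NO estimate of [Balaban1988Convergent] is asserted; no chart, no Jacobian, no gauge fixing; `hinnerSum` — where [I] §2 ∕ [III] §3 ∕ Thm 2 live — stays DISPLAYED.  N11 is NOT
discharged; K1⁸ is NOT closed.  One finite four-torus programme at fixed `ε = L^{−K}`: NOT ℝ⁴, NOT OS, NOT a mass gap, NOT Clay — R4 closes only the conditional finite-𝕋⁴ rung
`BalabanLadder.UV`.
-/

noncomputable section

open MeasureTheory ProbabilityTheory
open scoped ENNReal NNReal BigOperators

namespace Summit.QuantumFields.YangMills.Theorems.BalabanUVNodesN11TStepInnerIntegrandGraphIntegrable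

open Literature.MathematicalPhysics.QuantumFieldTheory.Balaban1983to89
open Literature.MathematicalPhysics.QuantumFieldTheory.Balaban1983to89.T4AveragingDisintegration
open BalabanUVNodesN11KernelTransportSkewProduct (map_prodMap_id_absolutelyContinuous)
open BalabanUVNodesN11AveragingSkewPresentationAtRecord (toFine_mem_compl_Omega_iff)
open BalabanUVNodesN11TStepBranchSum (baseCfg_succ_comp_glue_pinned TkOfRecord_succ_eq_sum_genOp ae_eq_of_comp_glue_ae_eq)
open BalabanUVNodesN11KernelRTSectionIntegrable (tstepOfRecord_comp_glue_ae_eq_sum_genOp_of_integrable_graph)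
open BalabanUVNodesN11TkBranchMassBound (tkBranchOfRecord_nonneg')
open Node00 hiding SU
open Node00.Tk T4Continuum
open B10Eq42TorusConstraint (bondsIn)
open B10Eq38TorusDomains (toFine)

/-! ## §1  The inner reading is integrable; nonnegative fibre summands of it are graph-product integrable -/

section Domination

variable (F : T4Family) (N : ℕ) [NeZero N]

/-- ★ **THE INNER READING IS INTEGRABLE**: for an integrable density `ρ` on `dU` and a saturated region `Y`, any `Fᵢ` a.e. equal to the kernel transport of `ρ`
(read through the level-`k` glue) along the skew presentation `(y, r) ↦ (y, avg(glue(y, r))|_{(bondsIn (k+1) Y)ᶜ})` — the `hin` row of p616225 ∕ p619836 — is integrable on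
`Π_{bondsIn k Y} Haar ⊗ Π_{(bondsIn (k+1) Y)ᶜ} Haar` (`integrable_kernelTransport`; dag-n11-e's measure-preserving glue, measurable rest factor and `hac_in` BY NAME).
[cite: Balaban1988Convergent, (2.21) p.258, (3.1) p.264 (bookkeeping)] -/
theorem integrable_innerReading (K k : ℕ) [DecidableEq (PBond (F.P K) k)] [DecidableEq (PBond (F.P K) (k + 1))] (hk : k + 1 ≤ (F.P K).m + (F.P K).K)
    {Y : Set (Site (F.P K) 0)} (hY : ∀ s : Site (F.P K) k, toFine k s ∈ Y ↔ toFine (k + 1) (blockOf s) ∈ Y)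
    {ρ : Density (F.P K) k (SU N)} (hρ : Integrable ρ (fieldMeasure (F.P K) k (SU N)))
    {Fᵢ : (↥(Set.toFinite (bondsIn k Y)).toFinset → SU N) × ({c : PBond (F.P K) (k + 1) // c ∉ (Set.toFinite (bondsIn (k + 1) Y)).toFinset} → SU N) → ℝ}
    (hin : kernelTransport
        ((Measure.pi fun _ : ↥(Set.toFinite (bondsIn k Y)).toFinset => (HaarData.haar : Measure (SU N))).prod
          (Measure.pi fun _ : {b : PBond (F.P K) k // b ∉ (Set.toFinite (bondsIn k Y)).toFinset} => (HaarData.haar : Measure (SU N))))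
        ((Measure.pi fun _ : ↥(Set.toFinite (bondsIn k Y)).toFinset => (HaarData.haar : Measure (SU N))).prod
          (Measure.pi fun _ : {c : PBond (F.P K) (k + 1) // c ∉ (Set.toFinite (bondsIn (k + 1) Y)).toFinset} => (HaarData.haar : Measure (SU N))))
        (fun q => (q.1, fun c : {c : PBond (F.P K) (k + 1) // c ∉ (Set.toFinite (bondsIn (k + 1) Y)).toFinset} =>
          (avOfRecord F N K k).avg
            ((MeasurableEquiv.piEquivPiSubtypeProd (fun _ : PBond (F.P K) k => SU N) (· ∈ (Set.toFinite (bondsIn k Y)).toFinset)).symm q) c))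
        (ρ ∘ ⇑(MeasurableEquiv.piEquivPiSubtypeProd (fun _ : PBond (F.P K) k => SU N) (· ∈ (Set.toFinite (bondsIn k Y)).toFinset)).symm)
      =ᵐ[(Measure.pi fun _ : ↥(Set.toFinite (bondsIn k Y)).toFinset => (HaarData.haar : Measure (SU N))).prod
          (Measure.pi fun _ : {c : PBond (F.P K) (k + 1) // c ∉ (Set.toFinite (bondsIn (k + 1) Y)).toFinset} => (HaarData.haar : Measure (SU N)))] Fᵢ) :
    Integrable Fᵢ ((Measure.pi fun _ : ↥(Set.toFinite (bondsIn k Y)).toFinset => (HaarData.haar : Measure (SU N))).prod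
      (Measure.pi fun _ : {c : PBond (F.P K) (k + 1) // c ∉ (Set.toFinite (bondsIn (k + 1) Y)).toFinset} => (HaarData.haar : Measure (SU N)))) := by
  have hρ' : Integrable (ρ ∘ ⇑(MeasurableEquiv.piEquivPiSubtypeProd (fun _ : PBond (F.P K) k => SU N) (· ∈ (Set.toFinite (bondsIn k Y)).toFinset)).symm)
      ((Measure.pi fun _ : ↥(Set.toFinite (bondsIn k Y)).toFinset => (HaarData.haar : Measure (SU N))).prod
        (Measure.pi fun _ : {b : PBond (F.P K) k // b ∉ (Set.toFinite (bondsIn k Y)).toFinset} => (HaarData.haar : Measure (SU N)))) :=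
    ((measurePreserving_piEquivPiSubtypeProd_symm_fieldMeasure (P := F.P K) (G := SU N) (Set.toFinite (bondsIn k Y)).toFinset).integrable_comp
      hρ.aestronglyMeasurable).2 hρ
  have hT := integrable_kernelTransport _
    ((Measure.pi fun _ : ↥(Set.toFinite (bondsIn k Y)).toFinset => (HaarData.haar : Measure (SU N))).prod
      (Measure.pi fun _ : {c : PBond (F.P K) (k + 1) // c ∉ (Set.toFinite (bondsIn (k + 1) Y)).toFinset} => (HaarData.haar : Measure (SU N))))
    (measurable_fst.prodMk (measurable_avOfRecord_glue_rest F N K k (Set.toFinite (bondsIn k Y)).toFinset (Set.toFinite (bondsIn (k + 1) Y)).toFinset))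
    (map_prod_avOfRecord_glue_skew_absolutelyContinuous_bondsIn F N K k hk hY) hρ'
  exact (hT.congr hin).congr (Filter.EventuallyEq.refl _ _)

/-- ★★ **NONNEGATIVE FIBRE SUMMANDS OF THE INNER READING ARE GRAPH-PRODUCT INTEGRABLE**: if a finite family of jointly measurable NONNEGATIVE integrands `G_i(q, y)` sums,
for `(Π_{sV'} Haar ⊗ Π_{sV'ᶜ} Haar)`-a.e. `q` and every `y` on the averaging fibre `avgRestrOfRecord y = q.1`, to the inner reading `Fᵢ(y, q.2)` (the `hinnerSum` row), then every
member is integrable along the graph `q := (avgRestrOfRecord y, z)` against `Π_{sV_k} Haar ⊗ Π_{sV'ᶜ} Haar` — the `hI` row of p622291: domination by the integrable `Fᵢ`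
(`integrable_innerReading`), the a.e. identification pulled back along `(y, z) ↦ (avgRestrOfRecord y, z)` (quasi-measure-preserving by dag-n11-e's `hac_out`).
[cite: Balaban1988Convergent, (2.18) p.257, (2.21) p.258, (3.1) p.264 (bookkeeping)] -/
theorem integrable_graph_of_fibre_sum_of_nonneg (K k : ℕ) [DecidableEq (PBond (F.P K) k)] [DecidableEq (PBond (F.P K) (k + 1))] (hk : k + 1 ≤ (F.P K).m + (F.P K).K)
    {Y : Set (Site (F.P K) 0)} (hY : ∀ s : Site (F.P K) k, toFine k s ∈ Y ↔ toFine (k + 1) (blockOf s) ∈ Y)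
    {ρ : Density (F.P K) k (SU N)} (hρ : Integrable ρ (fieldMeasure (F.P K) k (SU N)))
    {Fᵢ : (↥(Set.toFinite (bondsIn k Y)).toFinset → SU N) × ({c : PBond (F.P K) (k + 1) // c ∉ (Set.toFinite (bondsIn (k + 1) Y)).toFinset} → SU N) → ℝ}
    (hin : kernelTransport
        ((Measure.pi fun _ : ↥(Set.toFinite (bondsIn k Y)).toFinset => (HaarData.haar : Measure (SU N))).prod
          (Measure.pi fun _ : {b : PBond (F.P K) k // b ∉ (Set.toFinite (bondsIn k Y)).toFinset} => (HaarData.haar : Measure (SU N))))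
        ((Measure.pi fun _ : ↥(Set.toFinite (bondsIn k Y)).toFinset => (HaarData.haar : Measure (SU N))).prod
          (Measure.pi fun _ : {c : PBond (F.P K) (k + 1) // c ∉ (Set.toFinite (bondsIn (k + 1) Y)).toFinset} => (HaarData.haar : Measure (SU N))))
        (fun q => (q.1, fun c : {c : PBond (F.P K) (k + 1) // c ∉ (Set.toFinite (bondsIn (k + 1) Y)).toFinset} =>
          (avOfRecord F N K k).avg
            ((MeasurableEquiv.piEquivPiSubtypeProd (fun _ : PBond (F.P K) k => SU N) (· ∈ (Set.toFinite (bondsIn k Y)).toFinset)).symm q) c))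
        (ρ ∘ ⇑(MeasurableEquiv.piEquivPiSubtypeProd (fun _ : PBond (F.P K) k => SU N) (· ∈ (Set.toFinite (bondsIn k Y)).toFinset)).symm)
      =ᵐ[(Measure.pi fun _ : ↥(Set.toFinite (bondsIn k Y)).toFinset => (HaarData.haar : Measure (SU N))).prod
          (Measure.pi fun _ : {c : PBond (F.P K) (k + 1) // c ∉ (Set.toFinite (bondsIn (k + 1) Y)).toFinset} => (HaarData.haar : Measure (SU N)))] Fᵢ)
    {I : Type*} (ι : Finset I)
    {G : I → ((↥(Set.toFinite (bondsIn (k + 1) Y)).toFinset → SU N) × ({c : PBond (F.P K) (k + 1) // c ∉ (Set.toFinite (bondsIn (k + 1) Y)).toFinset} → SU N)) ×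
      (↥(Set.toFinite (bondsIn k Y)).toFinset → SU N) → ℝ}
    (hgm : ∀ i ∈ ι, Measurable (G i)) (hG0 : ∀ i ∈ ι, ∀ x, 0 ≤ G i x)
    (hsum : ∀ᵐ q ∂((Measure.pi fun _ : ↥(Set.toFinite (bondsIn (k + 1) Y)).toFinset => (HaarData.haar : Measure (SU N))).prod
          (Measure.pi fun _ : {c : PBond (F.P K) (k + 1) // c ∉ (Set.toFinite (bondsIn (k + 1) Y)).toFinset} => (HaarData.haar : Measure (SU N)))),
      ∀ y : ↥(Set.toFinite (bondsIn k Y)).toFinset → SU N,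
        avgRestrOfRecord F N K k (Set.toFinite (bondsIn k Y)).toFinset (Set.toFinite (bondsIn (k + 1) Y)).toFinset y = q.1 →
          Fᵢ (y, q.2) = ∑ i ∈ ι, G i (q, y)) :
    ∀ i ∈ ι, Integrable (fun p : (↥(Set.toFinite (bondsIn k Y)).toFinset → SU N) ×
        ({c : PBond (F.P K) (k + 1) // c ∉ (Set.toFinite (bondsIn (k + 1) Y)).toFinset} → SU N) =>
      G i ((avgRestrOfRecord F N K k (Set.toFinite (bondsIn k Y)).toFinset (Set.toFinite (bondsIn (k + 1) Y)).toFinset p.1, p.2), p.1))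
      ((Measure.pi fun _ : ↥(Set.toFinite (bondsIn k Y)).toFinset => (HaarData.haar : Measure (SU N))).prod
        (Measure.pi fun _ : {c : PBond (F.P K) (k + 1) // c ∉ (Set.toFinite (bondsIn (k + 1) Y)).toFinset} => (HaarData.haar : Measure (SU N)))) := by
  intro i hi
  have hFi := integrable_innerReading F N K k hk hY hρ hin
  have hmav := measurable_avgRestrOfRecord (F := F) (N := N) K k (Set.toFinite (bondsIn k Y)).toFinset (Set.toFinite (bondsIn (k + 1) Y)).toFinset
  have hq : Measure.QuasiMeasurePreserving
      (Prod.map (avgRestrOfRecord F N K k (Set.toFinite (bondsIn k Y)).toFinset (Set.toFinite (bondsIn (k + 1) Y)).toFinset) id)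
      ((Measure.pi fun _ : ↥(Set.toFinite (bondsIn k Y)).toFinset => (HaarData.haar : Measure (SU N))).prod
        (Measure.pi fun _ : {c : PBond (F.P K) (k + 1) // c ∉ (Set.toFinite (bondsIn (k + 1) Y)).toFinset} => (HaarData.haar : Measure (SU N))))
      ((Measure.pi fun _ : ↥(Set.toFinite (bondsIn (k + 1) Y)).toFinset => (HaarData.haar : Measure (SU N))).prod
        (Measure.pi fun _ : {c : PBond (F.P K) (k + 1) // c ∉ (Set.toFinite (bondsIn (k + 1) Y)).toFinset} => (HaarData.haar : Measure (SU N)))) :=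
    ⟨hmav.prodMap measurable_id, map_prodMap_id_absolutelyContinuous _ _ _ hmav
      (map_pi_avgRestrOfRecord_absolutelyContinuous_bondsIn F N K k hk hY)⟩
  refine hFi.mono' ((hgm i hi).comp (((hmav.comp measurable_fst).prodMk measurable_snd).prodMk measurable_fst)).aestronglyMeasurable ?_
  filter_upwards [hq.ae hsum] with p hp
  rw [Real.norm_eq_abs, abs_of_nonneg (hG0 i hi _)]
  have hpt := hp p.1 rfl
  calc G i ((avgRestrOfRecord F N K k (Set.toFinite (bondsIn k Y)).toFinset (Set.toFinite (bondsIn (k + 1) Y)).toFinset p.1, p.2), p.1)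
      ≤ ∑ j ∈ ι, G j ((avgRestrOfRecord F N K k (Set.toFinite (bondsIn k Y)).toFinset (Set.toFinite (bondsIn (k + 1) Y)).toFinset p.1, p.2), p.1) :=
        Finset.single_le_sum (fun j hj => hG0 j hj _) hi
    _ = Fᵢ p := hpt.symm

end Domination

/-! ## §2  p619836's branch-sum junction with `hint` replaced by nonnegativity of the explicit integrands -/

section BranchSum

variable {F : T4Family} {N : ℕ} [NeZero N]
variable {V : Type} [NormedAddCommGroup V] [InnerProductSpace ℝ V] [FiniteDimensional ℝ V] [MeasurableSpace V] [BorelSpace V]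

/-- ★★★ **THE BRANCH-SUM JUNCTION `_of_nonneg` — `hint` REDUNDANT UNDER POSITIVITY**: dag-n11-d's `…N11TStepBranchSum.tstepOfRecord_comp_glue_ae_eq_sum_genOp` (p619836)
with its row `hint` REPLACED by joint measurability `hgm` and POINTWISE NONNEGATIVITY `hG0` of the explicit inside integrands `ζ_i(ω_{y,q})·(aOp k sA_i w_i Φ_i)(ω_{y,q})`;
`hG` ∕ `hin` ∕ `hinnerSum` unchanged.  p622291's `_of_integrable_graph` edition fed by §1 (`Y := (Ω_{k+1}(s′))ᶜ`, `ρ :=` def-T's graph integrand, saturation by dag-n11-e's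
`toFine_mem_compl_Omega_iff`).  `hinnerSum` is where [I] §2 ∕ [III] §3 ∕ Thm 2 live — NOT proved here. [cite: Balaban1988Convergent, (2.18) p.257, (2.20)–(2.21) p.258, (3.1) p.264, (3.24)–(3.25) p.270] -/
theorem tstepOfRecord_comp_glue_ae_eq_sum_genOp_of_nonneg (ν : Stage7Numerics) (M : ℕ) (w : StepWeightsOfRecord F N ν M)
    (p : B12.RunParams) (g : ℕ → ℝ)
    {k : ℕ} (hkK : k < p.K) [DecidableEq (PBond (F.P p.K) k)] [DecidableEq (PBond (F.P p.K) (k + 1))] (hk : k + 1 ≤ (F.P p.K).m + (F.P p.K).K)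
    (T : SeqOfRecord F ν M g p.K k → Density (F.P p.K) k (SU N)) (s' : SeqOfRecord F ν M g p.K (k + 1))
    (hG : Integrable (fun U => w p g k s' U ((avOfRecord F N p.K k).avg U) * (chiSeqOfRecord F N ν M g p.K k s'.init U * T s'.init U))
      (fieldMeasure (F.P p.K) k (SU N)))
    {Fᵢ : (↥(Set.toFinite (bondsIn k (s'.Ω (k + 1))ᶜ)).toFinset → SU N) ×
        ({c : PBond (F.P p.K) (k + 1) // c ∉ (Set.toFinite (bondsIn (k + 1) (s'.Ω (k + 1))ᶜ)).toFinset} → SU N) → ℝ} (hFm : Measurable Fᵢ)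
    (hin : kernelTransport
        ((Measure.pi fun _ : ↥(Set.toFinite (bondsIn k (s'.Ω (k + 1))ᶜ)).toFinset => (HaarData.haar : Measure (SU N))).prod
          (Measure.pi fun _ : {b : PBond (F.P p.K) k // b ∉ (Set.toFinite (bondsIn k (s'.Ω (k + 1))ᶜ)).toFinset} => (HaarData.haar : Measure (SU N))))
        ((Measure.pi fun _ : ↥(Set.toFinite (bondsIn k (s'.Ω (k + 1))ᶜ)).toFinset => (HaarData.haar : Measure (SU N))).prod
          (Measure.pi fun _ : {c : PBond (F.P p.K) (k + 1) // c ∉ (Set.toFinite (bondsIn (k + 1) (s'.Ω (k + 1))ᶜ)).toFinset} => (HaarData.haar : Measure (SU N))))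
        (fun q => (q.1, fun c : {c : PBond (F.P p.K) (k + 1) // c ∉ (Set.toFinite (bondsIn (k + 1) (s'.Ω (k + 1))ᶜ)).toFinset} =>
          (avOfRecord F N p.K k).avg
            ((MeasurableEquiv.piEquivPiSubtypeProd (fun _ : PBond (F.P p.K) k => SU N)
              (· ∈ (Set.toFinite (bondsIn k (s'.Ω (k + 1))ᶜ)).toFinset)).symm q) c))
        ((fun U => w p g k s' U ((avOfRecord F N p.K k).avg U) * (chiSeqOfRecord F N ν M g p.K k s'.init U * T s'.init U)) ∘
          ⇑(MeasurableEquiv.piEquivPiSubtypeProd (fun _ : PBond (F.P p.K) k => SU N)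
            (· ∈ (Set.toFinite (bondsIn k (s'.Ω (k + 1))ᶜ)).toFinset)).symm)
      =ᵐ[(Measure.pi fun _ : ↥(Set.toFinite (bondsIn k (s'.Ω (k + 1))ᶜ)).toFinset => (HaarData.haar : Measure (SU N))).prod
          (Measure.pi fun _ : {c : PBond (F.P p.K) (k + 1) // c ∉ (Set.toFinite (bondsIn (k + 1) (s'.Ω (k + 1))ᶜ)).toFinset} => (HaarData.haar : Measure (SU N)))] Fᵢ)
    {I : Type*} (ι : Finset I) (W : I → TkWeights F N V p.K) (S : I → ℕ → Set (Site (F.P p.K) 0)) (Φ : I → MultiCfg (F.P p.K) (SU N) V → ℝ)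
    (ωOf : (↥(Set.toFinite (bondsIn (k + 1) (s'.Ω (k + 1))ᶜ)).toFinset → SU N) ×
        ({c : PBond (F.P p.K) (k + 1) // c ∉ (Set.toFinite (bondsIn (k + 1) (s'.Ω (k + 1))ᶜ)).toFinset} → SU N) → MultiCfg (F.P p.K) (SU N) V)
    (hω : ∀ q, (fun b : ↥(Set.toFinite (bondsIn (k + 1) (s'.Ω (k + 1))ᶜ)).toFinset => ((ωOf q) (k + 1)).1 (b : PBond (F.P p.K) (k + 1))) = q.1)
    (hgm : ∀ i ∈ ι, Measurable fun x :
        ((↥(Set.toFinite (bondsIn (k + 1) (s'.Ω (k + 1))ᶜ)).toFinset → SU N) ×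
            ({c : PBond (F.P p.K) (k + 1) // c ∉ (Set.toFinite (bondsIn (k + 1) (s'.Ω (k + 1))ᶜ)).toFinset} → SU N)) ×
          (↥(Set.toFinite (bondsIn k (s'.Ω (k + 1))ᶜ)).toFinset → SU N) =>
      zetaOp (genDataOfRecord F N V ν M g p.K (W i) s' (S i) k).ζ
        (aOp k (genDataOfRecord F N V ν M g p.K (W i) s' (S i) k).sA (genDataOfRecord F N V ν M g p.K (W i) s' (S i) k).w (Φ i))
        (Function.update (ωOf x.1) k
          (Function.updateFinset ((ωOf x.1) k).1 (Set.toFinite (bondsIn k (s'.Ω (k + 1))ᶜ)).toFinset x.2, ((ωOf x.1) k).2)))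
    (hG0 : ∀ i ∈ ι, ∀ x :
        ((↥(Set.toFinite (bondsIn (k + 1) (s'.Ω (k + 1))ᶜ)).toFinset → SU N) ×
            ({c : PBond (F.P p.K) (k + 1) // c ∉ (Set.toFinite (bondsIn (k + 1) (s'.Ω (k + 1))ᶜ)).toFinset} → SU N)) ×
          (↥(Set.toFinite (bondsIn k (s'.Ω (k + 1))ᶜ)).toFinset → SU N),
      0 ≤ zetaOp (genDataOfRecord F N V ν M g p.K (W i) s' (S i) k).ζ
        (aOp k (genDataOfRecord F N V ν M g p.K (W i) s' (S i) k).sA (genDataOfRecord F N V ν M g p.K (W i) s' (S i) k).w (Φ i))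
        (Function.update (ωOf x.1) k
          (Function.updateFinset ((ωOf x.1) k).1 (Set.toFinite (bondsIn k (s'.Ω (k + 1))ᶜ)).toFinset x.2, ((ωOf x.1) k).2)))
    (hinnerSum : ∀ᵐ q ∂((Measure.pi fun _ : ↥(Set.toFinite (bondsIn (k + 1) (s'.Ω (k + 1))ᶜ)).toFinset => (HaarData.haar : Measure (SU N))).prod
          (Measure.pi fun _ : {c : PBond (F.P p.K) (k + 1) // c ∉ (Set.toFinite (bondsIn (k + 1) (s'.Ω (k + 1))ᶜ)).toFinset} => (HaarData.haar : Measure (SU N)))),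
      ∀ y : ↥(Set.toFinite (bondsIn k (s'.Ω (k + 1))ᶜ)).toFinset → SU N,
        avgRestrOfRecord F N p.K k (Set.toFinite (bondsIn k (s'.Ω (k + 1))ᶜ)).toFinset (Set.toFinite (bondsIn (k + 1) (s'.Ω (k + 1))ᶜ)).toFinset y = q.1 →
        Fᵢ (y, q.2) =
          ∑ i ∈ ι, zetaOp (genDataOfRecord F N V ν M g p.K (W i) s' (S i) k).ζ
            (aOp k (genDataOfRecord F N V ν M g p.K (W i) s' (S i) k).sA (genDataOfRecord F N V ν M g p.K (W i) s' (S i) k).w (Φ i))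
            (Function.update (ωOf q) k
              (Function.updateFinset ((ωOf q) k).1 (Set.toFinite (bondsIn k (s'.Ω (k + 1))ᶜ)).toFinset y, ((ωOf q) k).2))) :
    (tstepOfRecord F N ν M w p g k T s') ∘
        ⇑(MeasurableEquiv.piEquivPiSubtypeProd (fun _ : PBond (F.P p.K) (k + 1) => SU N) (· ∈ (Set.toFinite (bondsIn (k + 1) (s'.Ω (k + 1))ᶜ)).toFinset)).symm
      =ᵐ[(Measure.pi fun _ : ↥(Set.toFinite (bondsIn (k + 1) (s'.Ω (k + 1))ᶜ)).toFinset => (HaarData.haar : Measure (SU N))).prod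
          (Measure.pi fun _ : {c : PBond (F.P p.K) (k + 1) // c ∉ (Set.toFinite (bondsIn (k + 1) (s'.Ω (k + 1))ᶜ)).toFinset} => (HaarData.haar : Measure (SU N)))]
        fun q => ∑ i ∈ ι, genOp k (genDataOfRecord F N V ν M g p.K (W i) s' (S i) k) (Φ i) (ωOf q) :=
  tstepOfRecord_comp_glue_ae_eq_sum_genOp_of_integrable_graph ν M w p g hkK hk T s' hG hFm hin ι W S Φ ωOf hω hgm
    (integrable_graph_of_fibre_sum_of_nonneg F N p.K k hk (toFine_mem_compl_Omega_iff s' hk) hG hin ι hgm hG0 hinnerSum) hinnerSum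

end BranchSum

/-! ## §3  The identity of (O3′) on the nose without the `hint` row -/

section OnTheNose

variable {F : T4Family} {N : ℕ} [NeZero N]
variable {V : Type} [NormedAddCommGroup V] [InnerProductSpace ℝ V] [FiniteDimensional ℝ V] [MeasurableSpace V] [BorelSpace V]

/-- ★★★ **THE IDENTITY OF (O3′) ON THE NOSE `_of_laws` — NO `hint` ROW**: dag-n11-d's `slotsTOfRecord_succ_ae_eq_TkOfRecord_succ_of_innerSum` (p619836 §3) with `hint`
REPLACED by joint measurability `hgm` of the explicit integrands, 11a's WEIGHT LAWS `W.Laws` (`ζ ≥ 0`, `w ≥ 0`) and a NONNEGATIVE operand `hΦ0`: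
`slotsTOfRecord … (k+1) s′ =ᵐ[dV′] TkOfRecord F N V ν τ.M g K W (k+1) s′ Φ` modulo `hG` ∕ `hin` ∕ `hinnerSum` (unchanged, DISPLAYED).  §2 at the canonical data; nonnegativity of
`ζ·aOp(…)(𝐓_k(s′,S)Φ_S)` by 11a's `genDataOfRecord_laws`, `aOp_nonneg` and this lineage's `tkBranchOfRecord_nonneg'`; then p619836's `slotsTOfRecord_succ`, `TkOfRecord_succ_eq_sum_genOp`,
`baseCfg_succ_comp_glue_pinned`, `ae_eq_of_comp_glue_ae_eq` BY NAME. [cite: Balaban1988Convergent, (2.18) p.257, (2.20)–(2.21) p.258, (2.23) p.258, (3.1) p.264, (3.24)–(3.25) p.270, §3 p.279] -/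
theorem slotsTOfRecord_succ_ae_eq_TkOfRecord_succ_of_innerSum_of_laws (ν : Stage7Numerics) (τ : TowerNumerics) (E : B12.RunParams → ℝ)
    (w : StepWeightsOfRecord F N ν τ.M) (ppSel : PpSelOfRecord F ν τ.M) (p : B12.RunParams) (g : ℕ → ℝ) {k : ℕ} (hkK : k < p.K)
    {hdec : DecidableEq (PBond (F.P p.K) k)} {hdec' : DecidableEq (PBond (F.P p.K) (k + 1))} (hk : k + 1 ≤ (F.P p.K).m + (F.P p.K).K)
    (s' : SeqOfRecord F ν τ.M g p.K (k + 1)) (W : TkWeights F N V p.K)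
    (Φ : SFluct (F.P p.K) V → B15DeterminingSets.MSField (F.P p.K) (SU N) → ℝ)
    (hG : Integrable (fun U => w p g k s' U ((avOfRecord F N p.K k).avg U) *
      (chiSeqOfRecord F N ν τ.M g p.K k s'.init U * slotsOfRecord F N ν τ E w ppSel p g k s'.init U)) (fieldMeasure (F.P p.K) k (SU N)))
    {Fᵢ : (↥(Set.toFinite (bondsIn k (s'.Ω (k + 1))ᶜ)).toFinset → SU N) ×
        ({c : PBond (F.P p.K) (k + 1) // c ∉ (Set.toFinite (bondsIn (k + 1) (s'.Ω (k + 1))ᶜ)).toFinset} → SU N) → ℝ} (hFm : Measurable Fᵢ)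
    (hin : kernelTransport
        ((Measure.pi fun _ : ↥(Set.toFinite (bondsIn k (s'.Ω (k + 1))ᶜ)).toFinset => (HaarData.haar : Measure (SU N))).prod
          (Measure.pi fun _ : {b : PBond (F.P p.K) k // b ∉ (Set.toFinite (bondsIn k (s'.Ω (k + 1))ᶜ)).toFinset} => (HaarData.haar : Measure (SU N))))
        ((Measure.pi fun _ : ↥(Set.toFinite (bondsIn k (s'.Ω (k + 1))ᶜ)).toFinset => (HaarData.haar : Measure (SU N))).prod
          (Measure.pi fun _ : {c : PBond (F.P p.K) (k + 1) // c ∉ (Set.toFinite (bondsIn (k + 1) (s'.Ω (k + 1))ᶜ)).toFinset} => (HaarData.haar : Measure (SU N))))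
        (fun q => (q.1, fun c : {c : PBond (F.P p.K) (k + 1) // c ∉ (Set.toFinite (bondsIn (k + 1) (s'.Ω (k + 1))ᶜ)).toFinset} =>
          (avOfRecord F N p.K k).avg
            ((MeasurableEquiv.piEquivPiSubtypeProd (fun _ : PBond (F.P p.K) k => SU N)
              (· ∈ (Set.toFinite (bondsIn k (s'.Ω (k + 1))ᶜ)).toFinset)).symm q) c))
        ((fun U => w p g k s' U ((avOfRecord F N p.K k).avg U) *
            (chiSeqOfRecord F N ν τ.M g p.K k s'.init U * slotsOfRecord F N ν τ E w ppSel p g k s'.init U)) ∘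
          ⇑(MeasurableEquiv.piEquivPiSubtypeProd (fun _ : PBond (F.P p.K) k => SU N)
            (· ∈ (Set.toFinite (bondsIn k (s'.Ω (k + 1))ᶜ)).toFinset)).symm)
      =ᵐ[(Measure.pi fun _ : ↥(Set.toFinite (bondsIn k (s'.Ω (k + 1))ᶜ)).toFinset => (HaarData.haar : Measure (SU N))).prod
          (Measure.pi fun _ : {c : PBond (F.P p.K) (k + 1) // c ∉ (Set.toFinite (bondsIn (k + 1) (s'.Ω (k + 1))ᶜ)).toFinset} => (HaarData.haar : Measure (SU N)))] Fᵢ)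
    (hgm : ∀ S ∈ admSOfRecord F ν τ.M g p.K (k + 1) s', Measurable fun x :
        ((↥(Set.toFinite (bondsIn (k + 1) (s'.Ω (k + 1))ᶜ)).toFinset → SU N) ×
            ({c : PBond (F.P p.K) (k + 1) // c ∉ (Set.toFinite (bondsIn (k + 1) (s'.Ω (k + 1))ᶜ)).toFinset} → SU N)) ×
          (↥(Set.toFinite (bondsIn k (s'.Ω (k + 1))ᶜ)).toFinset → SU N) =>
      zetaOp (genDataOfRecord F N V ν τ.M g p.K W s' S k).ζ
        (aOp k (genDataOfRecord F N V ν τ.M g p.K W s' S k).sA (genDataOfRecord F N V ν τ.M g p.K W s' S k).w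
          (tkBranchOfRecord F N V ν τ.M g p.K W s' S k (fun ω => Φ (S, fun j => (ω j).2) (fun j => (ω j).1))))
        (Function.update (baseCfg (k + 1) ((MeasurableEquiv.piEquivPiSubtypeProd (fun _ : PBond (F.P p.K) (k + 1) => SU N)
                (· ∈ (Set.toFinite (bondsIn (k + 1) (s'.Ω (k + 1))ᶜ)).toFinset)).symm x.1)) k
          (Function.updateFinset ((baseCfg (V := V) (k + 1) ((MeasurableEquiv.piEquivPiSubtypeProd (fun _ : PBond (F.P p.K) (k + 1) => SU N)
                (· ∈ (Set.toFinite (bondsIn (k + 1) (s'.Ω (k + 1))ᶜ)).toFinset)).symm x.1)) k).1 (Set.toFinite (bondsIn k (s'.Ω (k + 1))ᶜ)).toFinset x.2,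
            ((baseCfg (V := V) (k + 1) ((MeasurableEquiv.piEquivPiSubtypeProd (fun _ : PBond (F.P p.K) (k + 1) => SU N)
                (· ∈ (Set.toFinite (bondsIn (k + 1) (s'.Ω (k + 1))ᶜ)).toFinset)).symm x.1)) k).2)))
    (hW : W.Laws) (hΦ0 : ∀ S ∈ admSOfRecord F ν τ.M g p.K (k + 1) s', ∀ ω : MultiCfg (F.P p.K) (SU N) V, 0 ≤ Φ (S, fun j => (ω j).2) (fun j => (ω j).1))
    (hinnerSum : ∀ᵐ q ∂((Measure.pi fun _ : ↥(Set.toFinite (bondsIn (k + 1) (s'.Ω (k + 1))ᶜ)).toFinset => (HaarData.haar : Measure (SU N))).prod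
          (Measure.pi fun _ : {c : PBond (F.P p.K) (k + 1) // c ∉ (Set.toFinite (bondsIn (k + 1) (s'.Ω (k + 1))ᶜ)).toFinset} => (HaarData.haar : Measure (SU N)))),
      ∀ y : ↥(Set.toFinite (bondsIn k (s'.Ω (k + 1))ᶜ)).toFinset → SU N,
        avgRestrOfRecord F N p.K k (Set.toFinite (bondsIn k (s'.Ω (k + 1))ᶜ)).toFinset (Set.toFinite (bondsIn (k + 1) (s'.Ω (k + 1))ᶜ)).toFinset y = q.1 →
        Fᵢ (y, q.2) =
          ∑ S ∈ admSOfRecord F ν τ.M g p.K (k + 1) s', zetaOp (genDataOfRecord F N V ν τ.M g p.K W s' S k).ζ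
            (aOp k (genDataOfRecord F N V ν τ.M g p.K W s' S k).sA (genDataOfRecord F N V ν τ.M g p.K W s' S k).w
              (tkBranchOfRecord F N V ν τ.M g p.K W s' S k (fun ω => Φ (S, fun j => (ω j).2) (fun j => (ω j).1))))
            (Function.update (baseCfg (k + 1) ((MeasurableEquiv.piEquivPiSubtypeProd (fun _ : PBond (F.P p.K) (k + 1) => SU N)
                (· ∈ (Set.toFinite (bondsIn (k + 1) (s'.Ω (k + 1))ᶜ)).toFinset)).symm q)) k
              (Function.updateFinset ((baseCfg (V := V) (k + 1) ((MeasurableEquiv.piEquivPiSubtypeProd (fun _ : PBond (F.P p.K) (k + 1) => SU N)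
                (· ∈ (Set.toFinite (bondsIn (k + 1) (s'.Ω (k + 1))ᶜ)).toFinset)).symm q)) k).1 (Set.toFinite (bondsIn k (s'.Ω (k + 1))ᶜ)).toFinset y,
                ((baseCfg (V := V) (k + 1) ((MeasurableEquiv.piEquivPiSubtypeProd (fun _ : PBond (F.P p.K) (k + 1) => SU N)
                  (· ∈ (Set.toFinite (bondsIn (k + 1) (s'.Ω (k + 1))ᶜ)).toFinset)).symm q)) k).2))) :
    slotsTOfRecord F N ν τ E w ppSel p g (k + 1) s' =ᵐ[fieldMeasure (F.P p.K) (k + 1) (SU N)] TkOfRecord F N V ν τ.M g p.K W (k + 1) s' Φ :=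
  ae_eq_of_comp_glue_ae_eq p.K (k + 1) _ (by
    have h := tstepOfRecord_comp_glue_ae_eq_sum_genOp_of_nonneg ν τ.M w p g hkK hk (slotsOfRecord F N ν τ E w ppSel p g k) s' hG hFm hin
      (admSOfRecord F ν τ.M g p.K (k + 1) s') (fun _ => W) (fun S => S)
      (fun S => tkBranchOfRecord F N V ν τ.M g p.K W s' S k (fun ω => Φ (S, fun j => (ω j).2) (fun j => (ω j).1)))
      (fun q => baseCfg (k + 1) ((MeasurableEquiv.piEquivPiSubtypeProd (fun _ : PBond (F.P p.K) (k + 1) => SU N)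
        (· ∈ (Set.toFinite (bondsIn (k + 1) (s'.Ω (k + 1))ᶜ)).toFinset)).symm q))
      (baseCfg_succ_comp_glue_pinned p.K k _) hgm
      (fun S hS x => mul_nonneg ((genDataOfRecord_laws F N V ν τ.M g p.K hW s' S k).zeta_nonneg _)
        (aOp_nonneg k _ (genDataOfRecord_laws F N V ν τ.M g p.K hW s' S k).w_nonneg
          (fun ω => tkBranchOfRecord_nonneg' ν τ.M g p.K W s' S (fun j ω => hW.zeta_nonneg j _ ω)
            (fun j ω => TkWeights.w_nonneg hW j _ _ _ ω) (hΦ0 S hS) k ω) _))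
      hinnerSum
    rw [slotsTOfRecord_succ]
    filter_upwards [h] with q hq
    rw [hq, Function.comp_apply, TkOfRecord_succ_eq_sum_genOp ν τ.M g p.K W (hdec := hdec) s' Φ])

end OnTheNose

end Summit.QuantumFields.YangMills.Theorems.BalabanUVNodesN11TStepInnerIntegrandGraphIntegrable

end
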